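import Mathlib
import HarnessLib
import Summits.ABC.ABC.Theses.GlobalQuasiLogDerivative

/-!
# Line `birth` — BC3 skeleton for the crux `SeparationUpgrade` (stmt-ABC-11487)

Route `GlobalQuasiLogDerivative` (route-ABC-GlobalQuasiLogDerivative), crux (rank 4)
`SeparationUpgrade := SmallCoherentNonConstant → SeparatingQuasiLogDerivativesR`:
from SOME non-constant coherent (ε,C)-small `k : ℕ → ℤ` for every `ε > 0` to ENOUGH of them — for every
`ε > 0` one constant `C` and, for every abc triple `(a,b,c)` with `a ≠ b`, a coherent (ε,C)-small `k` with
`rad a·k b ≠ rad b·k a`.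

Notation (informal; the Lean below is fully unfolded, in the route's own spelling):
`Coh k` := ∀ coprime `x,y > 0`, `(x+y) ∣ rad(x+y)·D_k(x,y)` with `D_k(x,y) = rad x·k y − rad y·k x`;
`Small ε C k` := `|D_k(x,y)| ≤ C·rad x·rad y·(x+y)^ε` on coprime pairs; `s = k/rad`.

THE LINE — one generator plus ADAMS POWER TWISTS `ψ^d : k ↦ (n ↦ k (n^d))`.
* `ψ^d` preserves coherence (`stub_powerTwistCoherent`, TRUE, size M: for odd `d`, `e(x+y) ∣ e(x^d+y^d)`
  because `v_p(x^d+y^d) ≥ v_p(x+y)` at every `p ∣ x+y`; for even `d`, `x ≡ −y (mod p^v)` gives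
  `p^v ∣ x^d − y^d` and the `−` clause of the route's support item `LocalForm` (stmt-ABC-1693, → direction:
  CRT chain through a fresh `c ≡ −a (mod p^{j+1})`, `c ≡ 1 (mod rad(ab))`, and the cocycle
  `rad c·D(a,b) = rad a·D(c,b) + rad b·D(a,c)`) gives `p^{v−1} ∣ D(x^d,y^d)`).
* `ψ^d` maps (ε,C)-small to (d·ε, C)-small WITH THE SAME `C` (`rad(n^d) = rad n`, `x^d+y^d ≤ (x+y)^d`) —
  proved below (`small_powerTwist`), so the uniformity of `C` demanded by the target comes for free.
* What is left is a statement about ONE function (`stub_powerSeparation`, LOAD-BEARING, conjectural): a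
  non-constant coherent (ε',C)-small `k` cannot glue a whole power tower `(a^d, b^d)`, `1 ≤ d ≤ D₀`, of a coprime
  pair `a ≠ b`, with `D₀·ε' ≤ ε` (so that all the twists used land in exponent `ε`). Sanity in the polynomial
  regime (`s = P(n)`, `P` even of degree `2j ≤ ε'`, the only coherent functions known): `d ↦ P(b^d) − P(a^d)` is a
  real exponential sum with `≤ 2j+1` terms, hence has `≤ 2j` real zeros (Descartes/Laguerre), so `D₀ ≈ √ε` works.
  Why it might fail: a transcendental small coherent `s` (if any exists — crux SmallCoherentNonConstant) could be
  constant along a full power tower, which is p-adically thin for every `p` (LocalForm does not forbid it). If it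
  fails, the upgrade needs genuinely independent elements of `L_ε` (the card's mechanism (2)) — a different line.
* Composition (sorry-free, standard axioms): `separating_of_stubs` = given `ε`, take `ε', D₀` from
  `stub_powerSeparation`, one non-constant `k ∈ L_{ε',C}` from `SmallCoherentNonConstant`, and for each guarded abc
  pair `(a,b)` the twist `ψ^d k` with the `d ≤ D₀` that separates `(a^d,b^d)`: coherent by the first stub,
  (ε,C)-small by `small_powerTwist` (exponent `d·ε' ≤ D₀·ε' ≤ ε`), separating because `rad(a^d) = rad a`.
  `SeparationUpgrade_of : SeparationUpgrade` is the crux BY NAME (the only theorem whose head is the crux).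

Disproof used: none exists for this crux (`ledger crux ls stmt-ABC-11487`: no workfiles, no Negative lemmas).
`sorry` occurs ONLY in the two `stub_*` theorems.
-/

-- `Summit.<Summit>.<Problem>`: for the single-conjunct summit `ABC` the duplicate `ABC.ABC` is mandated.
set_option linter.dupNamespace false
set_option linter.unusedVariables false

namespace Summit.ABC.ABC.Cruxes.SeparationUpgrade.Birth

open Summit.ABC.ABC.Theses.GlobalQuasiLogDerivative

/-! ## The two registered stubs (statements fully unfolded; registered verbatim) -/

/-- **Stub 1 — power twists preserve coherence** (TRUE; size M). If `k` is coherent then so is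
`n ↦ k (n^d)` for every `d ≥ 1`: for coprime `x, y > 0` and `p^v ∥ x+y`, `x ≡ −y (mod p^v)` gives
`p^v ∣ x^d + y^d` (`d` odd: coherence of `k` at the coprime pair `(x^d, y^d)`) or `p^v ∣ x^d − y^d` (`d` even:
the `−` clause of `LocalForm`, stmt-ABC-1693, → direction), whence `p^{v−1} ∣ rad x·k(y^d) − rad y·k(x^d)`
(`rad(x^d) = rad x`); assemble over `p ∣ x+y`. Leans on: `LocalForm` (→), Mathlib `radical_pow`,
`Nat.Coprime.pow`. Sources: route item LocalForm; CegielskiGrigorieffGuessarian2015. -/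
theorem stub_powerTwistCoherent :
    ∀ k : ℕ → ℤ,
      (∀ x y : ℕ, 0 < x → 0 < y → Nat.Coprime x y →
        ((x + y : ℕ) : ℤ) ∣ ((UniqueFactorizationMonoid.radical (x + y) : ℕ) : ℤ) *
          (((UniqueFactorizationMonoid.radical x : ℕ) : ℤ) * k y -
            ((UniqueFactorizationMonoid.radical y : ℕ) : ℤ) * k x)) →
      ∀ d : ℕ, 0 < d → ∀ x y : ℕ, 0 < x → 0 < y → Nat.Coprime x y →
        ((x + y : ℕ) : ℤ) ∣ ((UniqueFactorizationMonoid.radical (x + y) : ℕ) : ℤ) *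
          (((UniqueFactorizationMonoid.radical x : ℕ) : ℤ) * k (y ^ d) -
            ((UniqueFactorizationMonoid.radical y : ℕ) : ℤ) * k (x ^ d)) := by
  sorry

/-- **Stub 2 — power separation** (LOAD-BEARING; conjectural). For every `ε > 0` there are an exponent
`ε' > 0` and a twist bound `D₀` with `D₀·ε' ≤ ε` such that every coherent, (ε',C)-small (any `C`),
NON-CONSTANT `k` separates some power `(a^d, b^d)`, `1 ≤ d ≤ D₀`, of every coprime pair `a ≠ b` of positive
integers: `rad(a^d)·k(b^d) ≠ rad(b^d)·k(a^d)`, i.e. `s(a^d) ≠ s(b^d)`. Equivalently: the orbit of `k` under the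
only known symmetries of coherence (integer combinations, constants, power twists of bounded order) already
separates every guarded pair. Why plausibly true: in the polynomial regime (`s = P(n)`, `P` even, `deg P ≤ ε'`)
`d ↦ P(b^d) − P(a^d)` is a real exponential sum with `≤ deg P + 1` terms and so vanishes for `≤ deg P` values
of `d`; `D₀ ≈ √ε`, `ε' = ε/D₀` works. Why it might fail: a transcendental small coherent `s` constant along a
whole power tower of one coprime pair (p-adically thin for every `p`). Size: L (it is where the crux lives).
Sources: Pasten2021 (arXiv:2106.16165, Lemma 3.5: independence per equation via Siegel), HallRR1971PseudoPolynomials,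
DelaygueRivoal2022 (arXiv:2102.01534). -/
theorem stub_powerSeparation :
    ∀ ε : ℝ, 0 < ε → ∃ ε' : ℝ, 0 < ε' ∧ ∃ D₀ : ℕ, (D₀ : ℝ) * ε' ≤ ε ∧
      ∀ (C : ℝ) (k : ℕ → ℤ),
        (∀ x y : ℕ, 0 < x → 0 < y → Nat.Coprime x y →
          ((x + y : ℕ) : ℤ) ∣ ((UniqueFactorizationMonoid.radical (x + y) : ℕ) : ℤ) *
            (((UniqueFactorizationMonoid.radical x : ℕ) : ℤ) * k y -
              ((UniqueFactorizationMonoid.radical y : ℕ) : ℤ) * k x)) →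
        (∀ x y : ℕ, 0 < x → 0 < y → Nat.Coprime x y →
          |((UniqueFactorizationMonoid.radical x : ℕ) : ℝ) * (k y : ℝ) -
              ((UniqueFactorizationMonoid.radical y : ℕ) : ℝ) * (k x : ℝ)| ≤
            C * ((UniqueFactorizationMonoid.radical x : ℕ) : ℝ) *
              ((UniqueFactorizationMonoid.radical y : ℕ) : ℝ) * ((x + y : ℕ) : ℝ) ^ ε') →
        (∃ a b : ℕ, 0 < a ∧ 0 < b ∧
          ((UniqueFactorizationMonoid.radical a : ℕ) : ℤ) * k b ≠
            ((UniqueFactorizationMonoid.radical b : ℕ) : ℤ) * k a) →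
        ∀ a b : ℕ, 0 < a → 0 < b → Nat.Coprime a b → a ≠ b →
          ∃ d : ℕ, 0 < d ∧ d ≤ D₀ ∧
            ((UniqueFactorizationMonoid.radical (a ^ d) : ℕ) : ℤ) * k (b ^ d) ≠
              ((UniqueFactorizationMonoid.radical (b ^ d) : ℕ) : ℤ) * k (a ^ d) := by
  sorry

/-! ## Sorry-free infrastructure: power twists transport smallness with the same constant -/

/-- A smallness hypothesis forces `0 ≤ C` (test it at the coprime pair `(1,1)`). [folklore] -/
theorem nonneg_of_small {ε C : ℝ} {k : ℕ → ℤ}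
    (hsmall : ∀ x y : ℕ, 0 < x → 0 < y → Nat.Coprime x y →
      |((UniqueFactorizationMonoid.radical x : ℕ) : ℝ) * (k y : ℝ) -
          ((UniqueFactorizationMonoid.radical y : ℕ) : ℝ) * (k x : ℝ)| ≤
        C * ((UniqueFactorizationMonoid.radical x : ℕ) : ℝ) *
          ((UniqueFactorizationMonoid.radical y : ℕ) : ℝ) * ((x + y : ℕ) : ℝ) ^ ε) :
    0 ≤ C := by
  have h := hsmall 1 1 one_pos one_pos (Nat.coprime_one_left 1)
  simp only [UniqueFactorizationMonoid.radical_one, Nat.cast_one, one_mul, sub_self, abs_zero,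
    mul_one] at h
  -- h : 0 ≤ C * ((1 + 1 : ℕ) : ℝ) ^ ε
  have h2 : (0 : ℝ) < ((1 + 1 : ℕ) : ℝ) ^ ε := by positivity
  by_contra hC
  have hC' : C < 0 := not_le.mp hC
  have : C * ((1 + 1 : ℕ) : ℝ) ^ ε < 0 := mul_neg_of_neg_of_pos hC' h2
  linarith

/-- Real-exponent bookkeeping of the power twist: for naturals `x, y` and `d ≥ 1`, `0 ≤ ε`, `d·ε ≤ δ`,
`(x^d + y^d)^ε ≤ (x + y)^δ` as real powers (using `x^d + y^d ≤ (x+y)^d` and `x + y ≥ 1`). [folklore] -/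
theorem rpow_pow_add_pow_le {x y d : ℕ} (hx : 0 < x) (hd : 0 < d) {ε δ : ℝ} (hε : 0 ≤ ε)
    (hδ : (d : ℝ) * ε ≤ δ) :
    ((x ^ d + y ^ d : ℕ) : ℝ) ^ ε ≤ ((x + y : ℕ) : ℝ) ^ δ := by
  have hd0 : d ≠ 0 := Nat.pos_iff_ne_zero.mp hd
  have hnat : x ^ d + y ^ d ≤ (x + y) ^ d := pow_add_pow_le (Nat.zero_le x) (Nat.zero_le y) hd0
  have hcast : ((x ^ d + y ^ d : ℕ) : ℝ) ≤ ((x + y : ℕ) : ℝ) ^ d := by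
    have := (Nat.cast_le (α := ℝ)).mpr hnat
    simpa using this
  have hbase0 : (0 : ℝ) ≤ ((x ^ d + y ^ d : ℕ) : ℝ) := Nat.cast_nonneg _
  have hxy0 : (0 : ℝ) ≤ ((x + y : ℕ) : ℝ) := Nat.cast_nonneg _
  have hxy1 : (1 : ℝ) ≤ ((x + y : ℕ) : ℝ) := by exact_mod_cast (show 1 ≤ x + y by omega)
  calc ((x ^ d + y ^ d : ℕ) : ℝ) ^ ε
      ≤ (((x + y : ℕ) : ℝ) ^ d) ^ ε := Real.rpow_le_rpow hbase0 hcast hε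
    _ = ((x + y : ℕ) : ℝ) ^ ((d : ℝ) * ε) := by
        rw [Real.rpow_mul hxy0, Real.rpow_natCast]
    _ ≤ ((x + y : ℕ) : ℝ) ^ δ := Real.rpow_le_rpow_of_exponent_le hxy1 hδ

/-- **Smallness transport.** If `k` is (ε,C)-small (`0 ≤ C`, `0 ≤ ε`) then `n ↦ k (n^d)` is (δ,C)-small for
every `δ ≥ d·ε` — the SAME constant `C`, because `rad(n^d) = rad n` and `x^d + y^d ≤ (x+y)^d`. [folklore] -/
theorem small_powerTwist {ε C : ℝ} {k : ℕ → ℤ} (hC : 0 ≤ C) (hε : 0 ≤ ε)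
    (hsmall : ∀ x y : ℕ, 0 < x → 0 < y → Nat.Coprime x y →
      |((UniqueFactorizationMonoid.radical x : ℕ) : ℝ) * (k y : ℝ) -
          ((UniqueFactorizationMonoid.radical y : ℕ) : ℝ) * (k x : ℝ)| ≤
        C * ((UniqueFactorizationMonoid.radical x : ℕ) : ℝ) *
          ((UniqueFactorizationMonoid.radical y : ℕ) : ℝ) * ((x + y : ℕ) : ℝ) ^ ε)
    {d : ℕ} (hd : 0 < d) {δ : ℝ} (hδ : (d : ℝ) * ε ≤ δ) :
    ∀ x y : ℕ, 0 < x → 0 < y → Nat.Coprime x y →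
      |((UniqueFactorizationMonoid.radical x : ℕ) : ℝ) * (k (y ^ d) : ℝ) -
          ((UniqueFactorizationMonoid.radical y : ℕ) : ℝ) * (k (x ^ d) : ℝ)| ≤
        C * ((UniqueFactorizationMonoid.radical x : ℕ) : ℝ) *
          ((UniqueFactorizationMonoid.radical y : ℕ) : ℝ) * ((x + y : ℕ) : ℝ) ^ δ := by
  intro x y hx hy hxy
  have hd0 : d ≠ 0 := Nat.pos_iff_ne_zero.mp hd
  have h := hsmall (x ^ d) (y ^ d) (pow_pos hx d) (pow_pos hy d) (Nat.Coprime.pow d d hxy)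
  rw [UniqueFactorizationMonoid.radical_pow x hd0, UniqueFactorizationMonoid.radical_pow y hd0] at h
  refine h.trans ?_
  have hR : (0 : ℝ) ≤ C * ((UniqueFactorizationMonoid.radical x : ℕ) : ℝ) *
      ((UniqueFactorizationMonoid.radical y : ℕ) : ℝ) := by positivity
  exact mul_le_mul_of_nonneg_left (rpow_pow_add_pow_le (y := y) hx hd hε hδ) hR

/-! ## The composition: stub signatures ⟹ the crux (sorry-free, standard axioms) -/

/-- **The real composition.** From the two stub statements (taken as hypotheses, verbatim) the crux
`SmallCoherentNonConstant → SeparatingQuasiLogDerivativesR` follows: given `ε > 0`, `stub_powerSeparation`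
supplies `ε' > 0` and `D₀` with `D₀·ε' ≤ ε`; `SmallCoherentNonConstant` at `ε'` supplies one coherent,
(ε',C)-small, non-constant `k`; for an abc triple `(a,b,c)` with `a ≠ b` (so `a, b > 0` coprime) the stub gives
`1 ≤ d ≤ D₀` with `rad(a^d)·k(b^d) ≠ rad(b^d)·k(a^d)`, and the twist `n ↦ k(n^d)` is coherent (first
hypothesis), (ε,C)-small with the same `C` (`small_powerTwist`, `d·ε' ≤ D₀·ε' ≤ ε`) and separates `(a,b)`
(`rad(a^d) = rad a`). The conclusion is deliberately the UNFOLDED crux so that `SeparationUpgrade_of` below is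
the only theorem whose head is the crux decl. [folklore] -/
theorem separating_of_stubs
    (hT : ∀ k : ℕ → ℤ,
      (∀ x y : ℕ, 0 < x → 0 < y → Nat.Coprime x y →
        ((x + y : ℕ) : ℤ) ∣ ((UniqueFactorizationMonoid.radical (x + y) : ℕ) : ℤ) *
          (((UniqueFactorizationMonoid.radical x : ℕ) : ℤ) * k y -
            ((UniqueFactorizationMonoid.radical y : ℕ) : ℤ) * k x)) →
      ∀ d : ℕ, 0 < d → ∀ x y : ℕ, 0 < x → 0 < y → Nat.Coprime x y →
        ((x + y : ℕ) : ℤ) ∣ ((UniqueFactorizationMonoid.radical (x + y) : ℕ) : ℤ) *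
          (((UniqueFactorizationMonoid.radical x : ℕ) : ℤ) * k (y ^ d) -
            ((UniqueFactorizationMonoid.radical y : ℕ) : ℤ) * k (x ^ d)))
    (hP : ∀ ε : ℝ, 0 < ε → ∃ ε' : ℝ, 0 < ε' ∧ ∃ D₀ : ℕ, (D₀ : ℝ) * ε' ≤ ε ∧
      ∀ (C : ℝ) (k : ℕ → ℤ),
        (∀ x y : ℕ, 0 < x → 0 < y → Nat.Coprime x y →
          ((x + y : ℕ) : ℤ) ∣ ((UniqueFactorizationMonoid.radical (x + y) : ℕ) : ℤ) *
            (((UniqueFactorizationMonoid.radical x : ℕ) : ℤ) * k y -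
              ((UniqueFactorizationMonoid.radical y : ℕ) : ℤ) * k x)) →
        (∀ x y : ℕ, 0 < x → 0 < y → Nat.Coprime x y →
          |((UniqueFactorizationMonoid.radical x : ℕ) : ℝ) * (k y : ℝ) -
              ((UniqueFactorizationMonoid.radical y : ℕ) : ℝ) * (k x : ℝ)| ≤
            C * ((UniqueFactorizationMonoid.radical x : ℕ) : ℝ) *
              ((UniqueFactorizationMonoid.radical y : ℕ) : ℝ) * ((x + y : ℕ) : ℝ) ^ ε') →
        (∃ a b : ℕ, 0 < a ∧ 0 < b ∧
          ((UniqueFactorizationMonoid.radical a : ℕ) : ℤ) * k b ≠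
            ((UniqueFactorizationMonoid.radical b : ℕ) : ℤ) * k a) →
        ∀ a b : ℕ, 0 < a → 0 < b → Nat.Coprime a b → a ≠ b →
          ∃ d : ℕ, 0 < d ∧ d ≤ D₀ ∧
            ((UniqueFactorizationMonoid.radical (a ^ d) : ℕ) : ℤ) * k (b ^ d) ≠
              ((UniqueFactorizationMonoid.radical (b ^ d) : ℕ) : ℤ) * k (a ^ d)) :
    SmallCoherentNonConstant → SeparatingQuasiLogDerivativesR := by
  intro hS ε hε
  obtain ⟨ε', hε', D₀, hD₀, hsep⟩ := hP ε hε
  obtain ⟨C, k, hcoh, hsmall, hnc⟩ := hS ε' hε'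
  refine ⟨C, ?_⟩
  intro a b c habc hab
  obtain ⟨ha, hb, hsum, hcop⟩ := habc
  obtain ⟨d, hd, hdD, hne⟩ := hsep C k hcoh hsmall hnc a b ha hb hcop hab
  have hd0 : d ≠ 0 := Nat.pos_iff_ne_zero.mp hd
  have hC : 0 ≤ C := nonneg_of_small hsmall
  have hδ : (d : ℝ) * ε' ≤ ε :=
    le_trans (mul_le_mul_of_nonneg_right (Nat.cast_le.mpr hdD) hε'.le) hD₀
  refine ⟨fun n => k (n ^ d), ?_, ?_, ?_⟩
  · intro x y hx hy hxy
    exact hT k hcoh d hd x y hx hy hxy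
  · intro x y hx hy hxy
    exact small_powerTwist hC hε'.le hsmall hd hδ x y hx hy hxy
  · rw [UniqueFactorizationMonoid.radical_pow a hd0, UniqueFactorizationMonoid.radical_pow b hd0] at hne
    exact hne

/-- **THE skeleton theorem** — the crux `SeparationUpgrade` BY NAME from the two declared stubs via the
sorry-free composition `separating_of_stubs` (`ledger skeleton check` shape: no hypotheses; `sorry` enters only
through `stub_powerTwistCoherent` and `stub_powerSeparation`). [folklore] -/
theorem SeparationUpgrade_of : SeparationUpgrade :=
  separating_of_stubs stub_powerTwistCoherent stub_powerSeparation

end Summit.ABC.ABC.Cruxes.SeparationUpgrade.Birth
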